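import Summits.MatrixMultiplication.MatrixMultiplication.Theorems.LevelGradedCohnUmansLevelOneGL2DesignsHermitianLiftCM
import Summits.MatrixMultiplication.MatrixMultiplication.Theorems.LevelGradedCohnUmansLevelOneGL2DesignsHermitianLiftCyclotomicPrelim

/-!
# The CM-Hermitian lift over cyclotomic fields, part 2: boxes and the tangency set of size `C^{r−1}·D^{r−2}`
(wall-breaker axis `Hermitian unital constructions`, stub `stub_tangencySets` of the crux `LevelOneGL2Designs`,
stmt-MatrixMultiplication-14080, k7 — file 4)

`K` an `r`-th cyclotomic field (`r = n + 2` prime) which is CM, `ζ ∈ K` a primitive `r`-th root of unity, `σ` = complex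
conjugation, `p ≡ 1 (mod r)` a prime.  The boxes

* abscissae `x(c) = Σ_{i ≤ n} cᵢ ζⁱ`, `c ∈ [0,C)^{n+1}` (the integral power basis — `n + 1 = [K:ℚ]` free directions,
  entering the collision quantity quadratically),
* heights `u(d) = Σ_{i<n} dᵢ (ζ^{i+1} − ζ^{n+1})`, `d ∈ [0,D)^{n}` — TRACE ZERO (`Tr ζʲ = −1` for `0 < j < r`), the
  `n = [K:ℚ] − 1` directions of the trace-zero hyperplane,

fed into the CM-Hermitian lift `…HermitianLiftCM.exists_tangencySet_cmLift` (points `(x, x·σx + u)`, tangent lines of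
the unitals `Y + σY = 2Xσ X + const`) give an affine tangency set of `AG(2,p)` with exactly `C^{r−1}·D^{r−2}` points as
soon as `(6r²C² + 4rD)^{r−1} < p` (`exists_tangencySet_cyclotomicLift`): under every complex embedding `|x| ≤ rC`,
`|u| ≤ 2rD`, so the collision quantity `F = 2(x−x')σx' − ((xσx+u) − (x'σx'+u'))` has `|τF| ≤ 6r²C² + 4rD` and hence
`|N(F)| < p` (`natAbs_norm_lt_of_forall_embedding`).  With `D = C²` and `p ≍ C^{2(r−1)}` this is
`C^{3(r−1)−1} ≍ p^{3/2 − 1/(r−1)}` points — the unital's exponent `3/2` up to `1/[K:ℚ]`, over PRIME fields, on the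
Hermitian axis; twice as close to `3/2` as the parabola lift through the real subfield `ℚ(ζ_r)⁺` at the same `r`
(Pohoata, arXiv:2607.20422, Thm 1.3: `3/2 − 2/(r−1)`).  No definitions.
-/

-- the summit/problem path `MatrixMultiplication.MatrixMultiplication` is fixed by the tree layout (D-0017)
set_option linter.dupNamespace false

noncomputable section

open Finset Polynomial NumberField
open scoped ComplexConjugate

namespace Summit.MatrixMultiplication.MatrixMultiplication.Theorems.LevelOneGL2Designs.HermitianLift

/-! ## A normed-field inequality for the collision quantity -/

/-- The archimedean size of the collision quantity: if `‖a‖, ‖a'‖, ‖b‖, ‖b'‖ ≤ A` and `‖u‖, ‖u'‖ ≤ A'` then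
`‖2(a − a')b' − ((ab + u) − (a'b' + u'))‖ ≤ 6A² + 2A'`. [elementary] -/
theorem norm_collision_le {a a' b b' u u' : ℂ} {A A' : ℝ} (ha : ‖a‖ ≤ A) (ha' : ‖a'‖ ≤ A) (hb : ‖b‖ ≤ A)
    (hb' : ‖b'‖ ≤ A) (hu : ‖u‖ ≤ A') (hu' : ‖u'‖ ≤ A') :
    ‖2 * (a - a') * b' - ((a * b + u) - (a' * b' + u'))‖ ≤ 6 * A ^ 2 + 2 * A' := by
  have hA : 0 ≤ A := le_trans (norm_nonneg _) ha
  have h1 : ‖2 * (a - a') * b'‖ ≤ 2 * (A + A) * A := by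
    rw [norm_mul, norm_mul, Complex.norm_two]
    have : ‖a - a'‖ ≤ A + A := le_trans (norm_sub_le _ _) (add_le_add ha ha')
    gcongr
  have h2 : ‖(a * b + u) - (a' * b' + u')‖ ≤ (A * A + A') + (A * A + A') := by
    refine le_trans (norm_sub_le _ _) (add_le_add ?_ ?_)
    · refine le_trans (norm_add_le _ _) (add_le_add ?_ hu)
      rw [norm_mul]; exact mul_le_mul ha hb (norm_nonneg _) hA
    · refine le_trans (norm_add_le _ _) (add_le_add ?_ hu')
      rw [norm_mul]; exact mul_le_mul ha' hb' (norm_nonneg _) hA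
  calc ‖2 * (a - a') * b' - ((a * b + u) - (a' * b' + u'))‖
      ≤ ‖2 * (a - a') * b'‖ + ‖(a * b + u) - (a' * b' + u')‖ := norm_sub_le _ _
    _ ≤ 2 * (A + A) * A + ((A * A + A') + (A * A + A')) := add_le_add h1 h2
    _ = 6 * A ^ 2 + 2 * A' := by ring

/-! ## The boxes (`r = n + 2`) -/

section Boxes

variable {K : Type*} [Field K] [NumberField K] {r : ℕ} [hr : Fact r.Prime] [IsCyclotomicExtension {r} ℚ K]
  {ζ : K} (hζ : IsPrimitiveRoot ζ r) {n : ℕ} (hn : r = n + 2)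

include hζ hn in
/-- Linear independence of `1, ζ, …, ζⁿ` over `ℚ` (`r = n + 2`): an integer combination `Σ_{i ≤ n} aᵢ ζⁱ` vanishes
only trivially. [elementary] -/
theorem intComb_eq_zero {a : Fin (n + 1) → ℤ} (h : (∑ i, (a i : K) * ζ ^ (i : ℕ)) = 0) : a = 0 := by
  haveI : NeZero r := ⟨hr.out.ne_zero⟩
  let pb := hζ.powerBasis ℚ
  have hdim : pb.dim = n + 1 := by
    rw [IsPrimitiveRoot.powerBasis_dim, ← cyclotomic_eq_minpoly_rat hζ hr.out.pos, natDegree_cyclotomic,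
      Nat.totient_prime hr.out, hn]
    rfl
  have hgen : pb.gen = ζ := IsPrimitiveRoot.powerBasis_gen _ _
  -- the family `i ↦ ζ^i`, `i : Fin (n+1)`, is linearly independent over `ℚ`
  have hli : LinearIndependent ℚ fun i : Fin (n + 1) => ζ ^ (i : ℕ) := by
    have h0 := pb.basis.linearIndependent
    have hfun : (fun i : Fin pb.dim => ζ ^ (i : ℕ)) = ⇑pb.basis := by
      funext i
      rw [PowerBasis.coe_basis, hgen]
    have h1 : LinearIndependent ℚ fun i : Fin pb.dim => ζ ^ (i : ℕ) := by
      rw [hfun]; exact h0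
    exact h1.comp (Fin.cast hdim.symm) (Fin.cast_injective _)
  have h' : (∑ i : Fin (n + 1), (a i : ℚ) • ζ ^ (i : ℕ)) = 0 := by
    rw [← h]
    refine Finset.sum_congr rfl fun i _ => ?_
    rw [Algebra.smul_def, map_intCast]
  have := Fintype.linearIndependent_iff.mp hli (fun i => (a i : ℚ)) h'
  funext i
  exact_mod_cast this i

include hζ hn in
/-- The same after multiplication by `ζ`: `Σ_{i ≤ n} aᵢ ζ^{i+1} = 0` only trivially. [elementary] -/
theorem intComb_succ_eq_zero {a : Fin (n + 1) → ℤ} (h : (∑ i, (a i : K) * ζ ^ ((i : ℕ) + 1)) = 0) : a = 0 := by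
  have hζ0 : ζ ≠ 0 := hζ.ne_zero hr.out.ne_zero
  refine intComb_eq_zero hζ hn ?_
  have : ζ * (∑ i, (a i : K) * ζ ^ (i : ℕ)) = 0 := by
    rw [Finset.mul_sum, ← h]
    refine Finset.sum_congr rfl fun i _ => ?_
    rw [pow_succ]; ring
  exact (mul_eq_zero.mp this).resolve_left hζ0

omit [NumberField K] [IsCyclotomicExtension {r} ℚ K] in
/-- Coercion of an abscissa `x(c) = Σ cᵢ ζⁱ ∈ 𝓞 K` to `K`. [elementary] -/
theorem coe_xBox (c : Fin (n + 1) → ℤ) :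
    ((∑ i, (c i : 𝓞 K) * hζ.toInteger ^ (i : ℕ) : 𝓞 K) : K) = ∑ i, (c i : K) * ζ ^ (i : ℕ) := by
  rw [RingOfIntegers.coe_eq_algebraMap]
  simp only [map_sum, map_mul, map_pow, map_intCast]
  rfl

omit [NumberField K] [IsCyclotomicExtension {r} ℚ K] in
/-- Coercion of a height `u(d) = Σ dᵢ (ζ^{i+1} − ζ^{n+1}) ∈ 𝓞 K` to `K`. [elementary] -/
theorem coe_uBox (d : Fin n → ℤ) :
    ((∑ i, (d i : 𝓞 K) * (hζ.toInteger ^ ((i : ℕ) + 1) - hζ.toInteger ^ (n + 1)) : 𝓞 K) : K) =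
      ∑ i, (d i : K) * (ζ ^ ((i : ℕ) + 1) - ζ ^ (n + 1)) := by
  rw [RingOfIntegers.coe_eq_algebraMap]
  simp only [map_sum, map_mul, map_pow, map_sub, map_intCast]
  rfl

include hn in
/-- **The abscissa box is injective**: `c ↦ Σ_{i ≤ n} cᵢ ζⁱ ∈ 𝓞 K`. [elementary] -/
theorem xBox_injective :
    Function.Injective fun c : Fin (n + 1) → ℤ => (∑ i, (c i : 𝓞 K) * hζ.toInteger ^ (i : ℕ)) := by
  intro c c' h
  have hK := congrArg (fun z : 𝓞 K => (z : K)) h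
  simp only [coe_xBox] at hK
  have h0 : (∑ i, ((c - c') i : K) * ζ ^ (i : ℕ)) = 0 := by
    rw [← sub_eq_zero] at hK
    rw [← hK, ← Finset.sum_sub_distrib]
    refine Finset.sum_congr rfl fun i _ => ?_
    rw [Pi.sub_apply, Int.cast_sub, sub_mul]
  exact sub_eq_zero.mp (intComb_eq_zero hζ hn h0)

include hn in
/-- **The height box is injective**: `d ↦ Σ_{i<n} dᵢ (ζ^{i+1} − ζ^{n+1}) ∈ 𝓞 K` (expand in `ζ, ζ², …, ζ^{n+1}`: the
coefficient of `ζ^{i+1}`, `i < n`, is `dᵢ`). [elementary] -/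
theorem uBox_injective :
    Function.Injective fun d : Fin n → ℤ =>
      (∑ i, (d i : 𝓞 K) * (hζ.toInteger ^ ((i : ℕ) + 1) - hζ.toInteger ^ (n + 1))) := by
  intro d d' h
  have hK := congrArg (fun z : 𝓞 K => (z : K)) h
  simp only [coe_uBox] at hK
  set e : Fin n → ℤ := d - d' with he
  have h0 : (∑ i, (e i : K) * (ζ ^ ((i : ℕ) + 1) - ζ ^ (n + 1))) = 0 := by
    rw [← sub_eq_zero] at hK
    rw [← hK, ← Finset.sum_sub_distrib]
    refine Finset.sum_congr rfl fun i _ => ?_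
    rw [he, Pi.sub_apply, Int.cast_sub, sub_mul]
  -- as a combination of `ζ, …, ζ^{n+1}` with coefficients `snoc e (-Σ e)`
  let a : Fin (n + 1) → ℤ := Fin.snoc e (-∑ i, e i)
  have ha : (∑ j : Fin (n + 1), (a j : K) * ζ ^ ((j : ℕ) + 1)) = 0 := by
    rw [Fin.sum_univ_castSucc]
    simp only [a, Fin.snoc_castSucc, Fin.snoc_last, Fin.val_castSucc, Fin.val_last, Int.cast_neg, Int.cast_sum,
      neg_mul, Finset.sum_mul]
    rw [← sub_eq_add_neg, ← Finset.sum_sub_distrib, ← h0]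
    refine Finset.sum_congr rfl fun i _ => ?_
    ring
  have ha0 := intComb_succ_eq_zero hζ hn ha
  funext i
  have := congrFun ha0 (Fin.castSucc i)
  simp only [a, Fin.snoc_castSucc, Pi.zero_apply] at this
  have hei : e i = 0 := this
  rw [he, Pi.sub_apply] at hei
  linarith

include hζ hn in
/-- **Heights are trace-zero**: `Tr_{K/ℚ}(u(d)) = 0` (every `ζʲ`, `0 < j < r`, has trace `−1`). [elementary] -/
theorem trace_uBox (d : Fin n → ℤ) :
    Algebra.trace ℚ K (∑ i, (d i : K) * (ζ ^ ((i : ℕ) + 1) - ζ ^ (n + 1))) = 0 := by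
  rw [map_sum]
  refine Finset.sum_eq_zero fun i _ => ?_
  have h1 : Algebra.trace ℚ K (ζ ^ ((i : ℕ) + 1)) = -1 :=
    trace_zeta_pow_eq_neg_one hζ (Nat.succ_pos _) (by have := i.isLt; omega)
  have h2 : Algebra.trace ℚ K (ζ ^ (n + 1)) = -1 :=
    trace_zeta_pow_eq_neg_one hζ (Nat.succ_pos _) (by omega)
  rw [show (d i : K) * (ζ ^ ((i : ℕ) + 1) - ζ ^ (n + 1)) = (d i : ℚ) • (ζ ^ ((i : ℕ) + 1) - ζ ^ (n + 1)) by
    rw [Algebra.smul_def, map_intCast], map_smul, map_sub, h1, h2, sub_self, smul_zero]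

include hζ in
omit [NumberField K] [IsCyclotomicExtension {r} ℚ K] in
/-- **Abscissae are archimedeanly small**: `‖τ x(c)‖ ≤ Σ |cᵢ|` under every embedding. [elementary] -/
theorem norm_embedding_xBox_le (τ : K →+* ℂ) (c : Fin (n + 1) → ℤ) :
    ‖τ (∑ i, (c i : K) * ζ ^ (i : ℕ))‖ ≤ ∑ i, (|c i| : ℝ) :=
  norm_embedding_intComb_le hζ hr.out.ne_zero τ c fun i => (i : ℕ)

include hζ in
omit [NumberField K] [IsCyclotomicExtension {r} ℚ K] in
/-- **Heights are archimedeanly small**: `‖τ u(d)‖ ≤ 2 Σ |dᵢ|` under every embedding. [elementary] -/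
theorem norm_embedding_uBox_le (τ : K →+* ℂ) (d : Fin n → ℤ) :
    ‖τ (∑ i, (d i : K) * (ζ ^ ((i : ℕ) + 1) - ζ ^ (n + 1)))‖ ≤ 2 * ∑ i, (|d i| : ℝ) := by
  rw [map_sum, Finset.mul_sum]
  refine le_trans (norm_sum_le _ _) (Finset.sum_le_sum fun i _ => ?_)
  rw [map_mul, map_intCast, norm_mul, Complex.norm_intCast, mul_comm]
  refine mul_le_mul_of_nonneg_right ?_ (by positivity)
  rw [map_sub, map_pow, map_pow]
  refine le_trans (norm_sub_le _ _) ?_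
  rw [norm_pow, norm_pow, norm_embedding_zeta hζ hr.out.ne_zero τ, one_pow, one_pow]
  norm_num

end Boxes

/-! ## Box sums -/

/-- A coordinate in `[0, C)` has absolute value `≤ C`, so a box vector in `[0,C)^m` has `Σ |cᵢ| ≤ m·C`. [elementary] -/
theorem sum_abs_le_of_mem_box {m : ℕ} {C : ℕ} {c : Fin m → ℤ} (hc : ∀ i, 0 ≤ c i ∧ c i < C) :
    (∑ i, (|c i| : ℝ)) ≤ m * C := by
  have : ∀ i ∈ (Finset.univ : Finset (Fin m)), (|c i| : ℝ) ≤ C := fun i _ => by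
    have h := hc i
    rw [abs_of_nonneg (by exact_mod_cast h.1)]
    exact_mod_cast h.2.le
  refine le_trans (Finset.sum_le_sum this) ?_
  rw [Finset.sum_const, Finset.card_univ, Fintype.card_fin, nsmul_eq_mul]

/-! ## The cyclotomic CM lift -/

/-- **The CM-Hermitian lift over `ℚ(ζ_r)`.**  Let `K` be an `r`-th cyclotomic field (`r` prime) which is CM, `ζ ∈ K` a
primitive `r`-th root of unity, `p ≡ 1 (mod r)` a prime and `C, D` with `(6r²C² + 4rD)^{r−1} < p`.  Then `AG(2,p)`
contains an affine tangency set — every point on a line meeting the set only there — with exactly `C^{r−1}·D^{r−2}`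
points: the reduction modulo a degree-one prime above `p` of the points `(x, x·x̄ + u)`, `x = Σ_{i<r−1} cᵢζⁱ`
(`c ∈ [0,C)^{r−1}`), `u = Σ_{i<r−2} dᵢ(ζ^{i+1} − ζ^{r−1})` (`d ∈ [0,D)^{r−2}`, trace zero), with the tangent lines
`Y − y' = 2x̄'(X − x')` of the Hermitian curves `Y + Ȳ = 2XX̄ + (u + ū)` through them.  With `D = C²`:
`C^{3(r−1)−1} ≍ p^{3/2 − 1/(r−1)}` points. [this project: the Hermitian-unital analogue, over the full CM field, of
Pohoata's real-subfield parabola lift arXiv:2607.20422 Prop. 5.1 / Thm. 1.3] -/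
theorem exists_tangencySet_cyclotomicLift {K : Type*} [Field K] [NumberField K] [IsCMField K]
    {r : ℕ} [Fact r.Prime] [IsCyclotomicExtension {r} ℚ K] {ζ : K} (hζ : IsPrimitiveRoot ζ r)
    {p : ℕ} [Fact p.Prime] (hmod : p % r = 1) (C D : ℕ)
    (hwin : ((6 * r ^ 2 * C ^ 2 + 4 * r * D : ℕ) : ℝ) ^ (r - 1) < p) :
    ∃ W : Finset (Fin 2 → ZMod p), W.card = C ^ (r - 1) * D ^ (r - 2) ∧
      ∀ v ∈ W, ∃ u : Fin 2 → ZMod p, u ≠ 0 ∧ ∀ w ∈ W, u ⬝ᵥ w = u ⬝ᵥ v → w = v := by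
  classical
  have hr := (Fact.out : r.Prime)
  obtain ⟨n, hn⟩ : ∃ n, r = n + 2 := ⟨r - 2, by have := hr.two_le; omega⟩
  have hr1 : r - 1 = n + 1 := by omega
  have hr2 : r - 2 = n := by omega
  -- the reduction map and complex conjugation on `𝓞 K`
  obtain ⟨g⟩ := exists_ringHom_ringOfIntegers_zmod (p := p) hζ hmod
  have hg : Function.Surjective g := ZMod.ringHom_surjective g
  set σ : 𝓞 K →+* 𝓞 K := (IsCMField.ringOfIntegersComplexConj K).toAlgHom.toRingHom with hσdef
  have hσ : ∀ z : 𝓞 K, ((σ z : 𝓞 K) : K) = IsCMField.complexConj K (z : K) := fun z =>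
    IsCMField.coe_ringOfIntegersComplexConj K z
  -- the boxes
  set ζI : 𝓞 K := hζ.toInteger with hζI
  let xOf : (Fin (n + 1) → ℤ) → 𝓞 K := fun c => ∑ i, (c i : 𝓞 K) * ζI ^ (i : ℕ)
  let uOf : (Fin n → ℤ) → 𝓞 K := fun d => ∑ i, (d i : 𝓞 K) * (ζI ^ ((i : ℕ) + 1) - ζI ^ (n + 1))
  set XB : Finset (Fin (n + 1) → ℤ) := Fintype.piFinset fun _ => Finset.Ico (0 : ℤ) C with hXB
  set UB : Finset (Fin n → ℤ) := Fintype.piFinset fun _ => Finset.Ico (0 : ℤ) D with hUB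
  have memXB : ∀ c ∈ XB, ∀ i, 0 ≤ c i ∧ c i < C := fun c hc i => by
    simpa using Fintype.mem_piFinset.mp hc i
  have memUB : ∀ d ∈ UB, ∀ i, 0 ≤ d i ∧ d i < D := fun d hd i => by
    simpa using Fintype.mem_piFinset.mp hd i
  set X : Finset (𝓞 K) := XB.image xOf with hX
  set U : Finset (𝓞 K) := UB.image uOf with hU
  -- archimedean bounds under an embedding
  have hxb : ∀ c ∈ XB, ∀ τ : K →+* ℂ, ‖τ (xOf c : K)‖ ≤ r * C := by
    intro c hc τ
    rw [show ((xOf c : 𝓞 K) : K) = ∑ i, (c i : K) * ζ ^ (i : ℕ) from coe_xBox hζ c]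
    refine le_trans (norm_embedding_xBox_le hζ τ c) (le_trans (sum_abs_le_of_mem_box (memXB c hc)) ?_)
    have : ((n + 1 : ℕ) : ℝ) ≤ r := by exact_mod_cast (by omega : n + 1 ≤ r)
    push_cast at this ⊢
    gcongr
  have hub : ∀ d ∈ UB, ∀ τ : K →+* ℂ, ‖τ (uOf d : K)‖ ≤ 2 * r * D := by
    intro d hd τ
    rw [show ((uOf d : 𝓞 K) : K) = ∑ i, (d i : K) * (ζ ^ ((i : ℕ) + 1) - ζ ^ (n + 1)) from coe_uBox hζ d]
    refine le_trans (norm_embedding_uBox_le hζ τ d) ?_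
    have h1 := sum_abs_le_of_mem_box (memUB d hd)
    have : ((n : ℕ) : ℝ) ≤ r := by exact_mod_cast (by omega : n ≤ r)
    nlinarith [h1, this, (Nat.cast_nonneg D : (0 : ℝ) ≤ D)]
  have hconj : ∀ (τ : K →+* ℂ) (z : 𝓞 K), ‖τ ((σ z : 𝓞 K) : K)‖ = ‖τ (z : K)‖ := fun τ z => by
    rw [hσ, IsCMField.complexEmbedding_complexConj K τ, Complex.norm_conj]
  -- the degree
  have hdeg : Module.finrank ℚ K = r - 1 := by
    haveI : NeZero r := ⟨hr.ne_zero⟩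
    rw [IsCyclotomicExtension.finrank K (cyclotomic.irreducible_rat hr.pos), Nat.totient_prime hr]
  -- traces on `U` are all zero
  have hUtr : ∀ u ∈ U, ∀ u' ∈ U, Algebra.trace ℚ K (u : K) = Algebra.trace ℚ K (u' : K) := by
    simp only [hU, Finset.mem_image]
    rintro _ ⟨d, hd, rfl⟩ _ ⟨d', hd', rfl⟩
    rw [show ((uOf d : 𝓞 K) : K) = _ from coe_uBox hζ d, show ((uOf d' : 𝓞 K) : K) = _ from coe_uBox hζ d',
      trace_uBox hζ hn, trace_uBox hζ hn]
  -- the norm window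
  have hWin : ∀ x ∈ X, ∀ x' ∈ X, ∀ u ∈ U, ∀ u' ∈ U,
      (Algebra.norm ℤ (2 * (x - x') * σ x' - ((x * σ x + u) - (x' * σ x' + u')))).natAbs < p := by
    simp only [hX, hU, Finset.mem_image]
    rintro _ ⟨c, hc, rfl⟩ _ ⟨c', hc', rfl⟩ _ ⟨d, hd, rfl⟩ _ ⟨d', hd', rfl⟩
    refine natAbs_norm_lt_of_forall_embedding _ (B := 6 * ((r : ℝ) * C) ^ 2 + 2 * (2 * (r : ℝ) * D))
      (fun τ => ?_) ?_
    · have hcoe : (((2 * (xOf c - xOf c') * σ (xOf c') - (xOf c * σ (xOf c) + uOf d - (xOf c' * σ (xOf c') + uOf d'))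
          : 𝓞 K) : K)) = 2 * ((xOf c : K) - (xOf c' : K)) * ((σ (xOf c') : 𝓞 K) : K) -
          ((xOf c : K) * ((σ (xOf c) : 𝓞 K) : K) + (uOf d : K) - ((xOf c' : K) * ((σ (xOf c') : 𝓞 K) : K) + (uOf d' : K))) := by
        simp only [RingOfIntegers.coe_eq_algebraMap, map_sub, map_mul, map_add, map_ofNat]
      rw [hcoe]
      simp only [map_sub, map_mul, map_add, map_ofNat]
      exact norm_collision_le (hxb c hc τ) (hxb c' hc' τ) ((hconj τ _).le.trans (hxb c hc τ))
        ((hconj τ _).le.trans (hxb c' hc' τ)) (hub d hd τ) (hub d' hd' τ)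
    · have hB : (6 * ((r : ℝ) * C) ^ 2 + 2 * (2 * (r : ℝ) * D)) = ((6 * r ^ 2 * C ^ 2 + 4 * r * D : ℕ) : ℝ) := by
        push_cast; ring
      rw [hdeg, hB]
      exact hwin
  -- apply the CM lift and count
  obtain ⟨W, hW, htan⟩ := exists_tangencySet_cmLift σ hσ g hg X U hUtr hWin
  refine ⟨W, ?_, htan⟩
  rw [hW, hX, hU, Finset.card_image_of_injective _ (xBox_injective hζ hn),
    Finset.card_image_of_injective _ (uBox_injective hζ hn), hXB, hUB, Fintype.card_piFinset,
    Fintype.card_piFinset]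
  simp [hr1, hr2]

end Summit.MatrixMultiplication.MatrixMultiplication.Theorems.LevelOneGL2Designs.HermitianLift
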